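import Literature.AlgebraicGeometry.HodgeTheory.ProjectiveSplitBundleRegularity
import Literature.Algebra.Homology.LaurentCechIdealSheafSequence
import HarnessLib

/-!
# `𝓘_X` is `m`-regular iff `𝒪_X` is `(m-1)`-regular and `H¹(𝓘_X(m-1)) = 0` (Mumford, Lecture 14)

Mumford, *Lectures on Curves on an Algebraic Surface*, Lecture 14 (pp. 99–102): a coherent sheaf `𝓕` on
`ℙ^r` is `m`-regular if `H^i(𝓕(m - i)) = 0` for all `i ≥ 1`. For an ideal sheaf the long exact sequence
of `0 → 𝓘_X → 𝒪_{ℙ^r} → 𝒪_X → 0` together with `H^i(ℙ^r, 𝒪(n)) = 0` for `0 < i < r` and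
`H^r(ℙ^r, 𝒪(n)) = 0` for `n ≥ -r` (III Thm. 5.1) gives the standard bookkeeping
**`𝓘_X` is `m`-regular ⟺ `𝒪_X` is `(m-1)`-regular and `H¹(𝓘_X(m-1)) = 0`** (`m ≥ 1`) — e.g. for a
zero-dimensional `Z` (every twist of `𝒪_Z` has no higher cohomology): `𝓘_Z` is `m`-regular iff
`H¹(𝓘_Z(m-1)) = 0`, iff `Z` imposes independent conditions on forms of degree `m - 1`.

In the tree's Čech language, for a submodule `K ⊆ F_e = ⊕_j P(-e_j)` (`Č_d(K)` = `LaurentCech.cech`,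
`Č_d(F_e ⧸ K)` = `LaurentCech.quot`; `k` a field, `r ≥ 1`, `J` finite; the free summands require
`e_j ≤ m - 1`, resp. `e_j ≤ m`, in place of `m ≥ 1`, resp. `m ≥ 0`, for `𝒪`):

* **`LaurentCech.regular_quot_of_regular_cech`** — `K~` `m`-regular and `e_j ≤ m - 1` for all `j`
  ⇒ `(F_e ⧸ K)~` is `(m-1)`-regular;
* **`LaurentCech.regular_cech_of_regular_quot`** — `(F_e ⧸ K)~` `(m-1)`-regular, `H¹(Č_{m-1}(K)) = 0`
  and `e_j ≤ m` for all `j` ⇒ `K~` is `m`-regular;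
* `LaurentCech.regular_cech_iff` — the equivalence (under `e_j ≤ m - 1`).

## References

* [Mumford1966CurvesSurface] D. Mumford, *Lectures on Curves on an Algebraic Surface*, Annals of Math.
  Studies 59, Princeton 1966, Lecture 14 (pp. 99–102).
* [Hartshorne1977] R. Hartshorne, *Algebraic Geometry*, III Thm. 5.1 (p. 225), III Ex. 5.10 (p. 231).
-/

noncomputable section

open CategoryTheory CategoryTheory.Limits

universe u

namespace Literature.Algebra.Homology

namespace LaurentCech

open OrderedCech TopCohomology

variable {k : Type u} [Field k] {r : ℕ} {J : Type} [Fintype J] (e : J → ℤ)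

/-- **`K~` `m`-regular ⇒ `(F_e ⧸ K)~` `(m-1)`-regular** when `e_j ≤ m - 1` for all `j` (for an ideal
sheaf in `𝒪_{ℙ^r}`: `m ≥ 1`): `H^i(Č_{m-1-i}(F_e ⧸ K))` sits between `H^i(Č_{m-1-i}(F_e)) = 0`
(`0 < i < r`; for `i = r` it is a quotient of `H^r(Č_{m-1-r}(F_e)) = 0` as `e_j ≤ m - 1`) and
`H^{i+1}(Č_{m-(i+1)}(K)) = 0`. [cite: Mumford1966CurvesSurface, Lecture 14 (pp. 99–102)]
[cite: Hartshorne1977, III Thm. 5.1 (p. 225)] -/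
theorem regular_quot_of_regular_cech (hr : 1 ≤ r) {K : Submodule (P k r) (J → P k r)} (m : ℤ)
    (he : ∀ j, e j ≤ m - 1) (hm : ∀ i : ℤ, 1 ≤ i → IsZero ((cech e K (m - i)).homology i)) :
    ∀ i : ℤ, 1 ≤ i → IsZero ((quot e K (m - 1 - i)).homology i) := by
  intro i hi
  by_cases hir : i < r
  · -- middle range: both neighbours vanish
    have hS := shortExact_quotSC e K (m - 1 - i)
    refine (hS.homology_exact₃ i (i + 1) (by simp)).isZero_of_both_zeros ?_ ?_
    · exact (isZero_homology_cech_top_of_pos_of_lt e (m - 1 - i) i (by omega) hir).eq_of_src _ _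
    · have h := hm (i + 1) (by omega)
      rw [show m - (i + 1) = m - 1 - i by ring] at h
      exact h.eq_of_tgt _ _
  · by_cases hieq : i = r
    · subst hieq
      have htop : IsZero ((cech e (⊤ : Submodule (P k r) (J → P k r)) (m - 1 - r)).homology r) :=
        (isZero_homology_cech_top_top_iff e hr (m - 1 - r)).2 fun j => by have := he j; omega
      haveI : Epi (HomologicalComplex.homologyMap (cokernel.π (inclusion e K ⊤ le_top (m - 1 - r)))
          (r : ℤ)) :=
        (ModuleCat.epi_iff_surjective _).2 (surjective_homologyMap_π_top e K (m - 1 - r))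
      exact htop.of_epi (HomologicalComplex.homologyMap (cokernel.π (inclusion e K ⊤ le_top (m - 1 - r)))
        (r : ℤ))
    · exact isZero_homology_quot_of_lt e K (m - 1 - i) i (by omega)

/-- **`(F_e ⧸ K)~` `(m-1)`-regular, `H¹(Č_{m-1}(K)) = 0` and `e_j ≤ m` for all `j` ⇒ `K~` is
`m`-regular** (for an ideal sheaf in `𝒪_{ℙ^r}`: `m ≥ 0`): for `i ≥ 2`, `H^i(Č_{m-i}(K))` sits between
`H^{i-1}(Č_{(m-1)-(i-1)}(F_e ⧸ K)) = 0` and `H^i(Č_{m-i}(F_e)) = 0`.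
[cite: Mumford1966CurvesSurface, Lecture 14 (pp. 99–102)] [cite: Hartshorne1977, III Thm. 5.1 (p. 225)] -/
theorem regular_cech_of_regular_quot (hr : 1 ≤ r) {K : Submodule (P k r) (J → P k r)} (m : ℤ)
    (he : ∀ j, e j ≤ m) (hq : ∀ i : ℤ, 1 ≤ i → IsZero ((quot e K (m - 1 - i)).homology i))
    (h1 : IsZero ((cech e K (m - 1)).homology 1)) :
    ∀ i : ℤ, 1 ≤ i → IsZero ((cech e K (m - i)).homology i) := by
  intro i hi
  by_cases hi1 : i = 1
  · subst hi1; exact h1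
  by_cases hir : i ≤ r
  · have hS := shortExact_quotSC e K (m - i)
    refine (hS.homology_exact₁ (i - 1) i (by simp)).isZero_of_both_zeros ?_ ?_
    · have h := hq (i - 1) (by omega)
      rw [show m - 1 - (i - 1) = m - i by ring] at h
      exact h.eq_of_src _ _
    · refine IsZero.eq_of_tgt ?_ _ _
      by_cases hir' : i < r
      · exact isZero_homology_cech_top_of_pos_of_lt e (m - i) i (by omega) hir'
      · have hieq : i = r := le_antisymm hir (not_lt.1 hir')
        subst hieq
        exact (isZero_homology_cech_top_top_iff e hr (m - r)).2 fun j => by have := he j; omega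
  · exact isZero_homology_cech_of_lt e K (m - i) i (by omega)

/-- **`K~` is `m`-regular ⟺ `(F_e ⧸ K)~` is `(m-1)`-regular and `H¹(Č_{m-1}(K)) = 0`** (`e_j ≤ m - 1`
for all `j`; for ideal sheaves `𝓘_X ⊆ 𝒪_{ℙ^r}`: `m ≥ 1`). In particular for a zero-dimensional `Z`
(`𝒪_Z` `n`-regular for every `n`) `𝓘_Z` is `m`-regular iff `H¹(𝓘_Z(m-1)) = 0`.
[cite: Mumford1966CurvesSurface, Lecture 14 (pp. 99–102)] -/
theorem regular_cech_iff (hr : 1 ≤ r) {K : Submodule (P k r) (J → P k r)} (m : ℤ)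
    (he : ∀ j, e j ≤ m - 1) :
    (∀ i : ℤ, 1 ≤ i → IsZero ((cech e K (m - i)).homology i)) ↔
      (∀ i : ℤ, 1 ≤ i → IsZero ((quot e K (m - 1 - i)).homology i)) ∧
        IsZero ((cech e K (m - 1)).homology 1) :=
  ⟨fun hm => ⟨regular_quot_of_regular_cech e hr m he hm, hm 1 le_rfl⟩,
    fun h => regular_cech_of_regular_quot e hr m (fun j => by have := he j; omega) h.1 h.2⟩

end LaurentCech

end Literature.Algebra.Homology

end
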